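import Literature.AnabelianGeometry.SemiGraphs.PSCSturdyCover
import HarnessLib

/-!
# [CombGC] Def. 1.1 (ii) level-wise / Rmk. 1.1.5 — sanity lemmas for `PSCSturdyCover.lean` (proof-only)

Proof-only companion (abc-iut cell, sub-DAG `plan/L3/SUBDAG-CombGC-Thm16.md` row T16-L07, seat
abc-iut-w5-d188) of the statements file `PSCSturdyCover.lean`: the level-wise kernel
`unrKerIn U = Ker(Π_{G_U} ↠ Π^unr_{G_U})` is contained in `U` (for closed, e.g. open, `U`) and in
`unrKer = Ker(Π_G ↠ Π^unr_G)`, and AT THE TRIVIAL COVERING `U = Π_G` it IS `unrKer`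
(`unrKerIn_top`), so that `unrVertAt ⊤ A = A ⊔ unrKer` is the tree's recording of the unramified
verticial subgroups (`PSCDatum.IsUnrVerticial`) and `IsSturdyAt ⊤` reads Def. 1.1 (ii) verbatim for `G`.
Mochizuki, *A combinatorial version of the Grothendieck conjecture* [CombGC], Def. 1.1 (ii), p. 7
[cite: MochizukiCombGC2007, Def 1.1(ii) p.7].  Elementary group theory; nothing here takes a side on
[IUTchIII] Cor. 3.12.
-/

namespace Literature.AnabelianGeometry.SemiGraphs

namespace PSCDatum

open scoped Pointwise

universe u

variable {P : Type u} [Group P] [TopologicalSpace P] [IsTopologicalGroup P] (G : PSCDatum P)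

omit [IsTopologicalGroup P] in
/-- The generating set of `unrKerIn U`, pushed into `Π_G`, is the union of the edge-like subgroups of
`Π_{G_U}`. [cite: MochizukiCombGC2007, Def 1.1(ii) p.7] -/
theorem subtype_image_edgeLikeInSet (U : Subgroup P) :
    (U.subtype '' {x : U | ∃ A : Subgroup P, G.IsEdgeLikeIn U A ∧ (x : P) ∈ A}) =
      {y : P | ∃ A : Subgroup P, G.IsEdgeLikeIn U A ∧ y ∈ A} := by
  ext y
  constructor
  · rintro ⟨x, ⟨A, hA, hxA⟩, rfl⟩
    exact ⟨A, hA, hxA⟩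
  · rintro ⟨A, hA, hyA⟩
    obtain ⟨B, hB, rfl⟩ := hA
    exact ⟨⟨y, (Subgroup.mem_inf.mp hyA).1⟩, ⟨U ⊓ B, ⟨B, hB, rfl⟩, hyA⟩, rfl⟩

/-- `unrKerIn U ≤ U` whenever `U` is closed (in particular for open `U`): the normal closure is taken
inside `U` and `U` is closed. [cite: MochizukiCombGC2007, Def 1.1(ii) p.7] -/
theorem unrKerIn_le (U : Subgroup P) (hU : IsClosed (U : Set P)) : G.unrKerIn U ≤ U := by
  unfold unrKerIn
  refine Subgroup.topologicalClosure_minimal _ ?_ hU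
  exact (Subgroup.map_subtype_le _)

/-- `unrKerIn U ≤ U` for OPEN `U` (open subgroups are closed). [cite: MochizukiCombGC2007, Def 1.1(ii) p.7] -/
theorem unrKerIn_le_of_isOpen (U : Subgroup P) (hU : IsOpen (U : Set P)) : G.unrKerIn U ≤ U :=
  G.unrKerIn_le U (Subgroup.isClosed_of_isOpen U hU)

/-- Every edge-like subgroup of `Π_{G_U}` lies in `Ker(Π_G ↠ Π^unr_G)`. [cite: MochizukiCombGC2007, Def 1.1(ii) p.7] -/
theorem le_unrKer_of_isEdgeLikeIn {U A : Subgroup P} (hA : G.IsEdgeLikeIn U A) : A ≤ G.unrKer := by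
  obtain ⟨B, hB, rfl⟩ := hA
  intro x hx
  have hxB : x ∈ B := (Subgroup.mem_inf.mp hx).2
  -- `B` is a conjugate `γ • Π_e` of a representative edge-like subgroup
  unfold unrKer
  apply Subgroup.le_topologicalClosure
  set S : Set P := (⋃ c, (G.cuspGp c : Set P)) ∪ ⋃ e, (G.nodeGp e : Set P) with hS
  rcases hB with ⟨e, γ, rfl⟩ | ⟨c, γ, rfl⟩
  · obtain ⟨a, ha, rfl⟩ := (Subgroup.mem_smul_pointwise_iff_exists _ _ _).mp hxB
    have haS : a ∈ S := Set.mem_union_right _ (Set.mem_iUnion.mpr ⟨e, ha⟩)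
    rw [ConjAct.smul_def]
    exact (Subgroup.normalClosure_normal (s := S)).conj_mem a (Subgroup.subset_normalClosure haS)
      (ConjAct.ofConjAct γ)
  · obtain ⟨a, ha, rfl⟩ := (Subgroup.mem_smul_pointwise_iff_exists _ _ _).mp hxB
    have haS : a ∈ S := Set.mem_union_left _ (Set.mem_iUnion.mpr ⟨c, ha⟩)
    rw [ConjAct.smul_def]
    exact (Subgroup.normalClosure_normal (s := S)).conj_mem a (Subgroup.subset_normalClosure haS)
      (ConjAct.ofConjAct γ)

/-- `unrKerIn U ≤ unrKer`: the level-wise kernel of `Π_{G_U} ↠ Π^unr_{G_U}` lies in that of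
`Π_G ↠ Π^unr_G`. [cite: MochizukiCombGC2007, Def 1.1(ii) p.7] -/
theorem unrKerIn_le_unrKer (U : Subgroup P) : G.unrKerIn U ≤ G.unrKer := by
  unfold unrKerIn
  haveI : G.unrKer.Normal := G.unrKer_normal
  refine Subgroup.topologicalClosure_minimal _ ?_ ?_
  · rw [Subgroup.map_le_iff_le_comap]
    refine Subgroup.normalClosure_le_normal ?_
    rintro x ⟨A, hA, hxA⟩
    exact G.le_unrKer_of_isEdgeLikeIn hA hxA
  · unfold unrKer
    exact Subgroup.isClosed_topologicalClosure _

/-- **At the trivial covering the level-wise kernel is `unrKer`**: `unrKerIn Π_G = Ker(Π_G ↠ Π^unr_G)`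
(the normal closure of ALL edge-like subgroups equals that of the chosen representatives).
[cite: MochizukiCombGC2007, Def 1.1(ii) p.7] -/
theorem unrKerIn_top : G.unrKerIn ⊤ = G.unrKer := by
  refine le_antisymm (G.unrKerIn_le_unrKer ⊤) ?_
  unfold unrKer unrKerIn
  refine Subgroup.topologicalClosure_mono ?_
  rw [Subgroup.map_normalClosure _ _ (fun y => ⟨⟨y, Subgroup.mem_top y⟩, rfl⟩),
    subtype_image_edgeLikeInSet]
  refine Subgroup.normalClosure_mono ?_
  rintro y (hy | hy)
  · obtain ⟨c, hyc⟩ := Set.mem_iUnion.mp hy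
    exact ⟨⊤ ⊓ G.cuspGp c, ⟨G.cuspGp c, Or.inr ⟨c, 1, by rw [one_smul]⟩, rfl⟩,
      Subgroup.mem_inf.mpr ⟨Subgroup.mem_top y, hyc⟩⟩
  · obtain ⟨e, hye⟩ := Set.mem_iUnion.mp hy
    exact ⟨⊤ ⊓ G.nodeGp e, ⟨G.nodeGp e, Or.inl ⟨e, 1, by rw [one_smul]⟩, rfl⟩,
      Subgroup.mem_inf.mpr ⟨Subgroup.mem_top y, hye⟩⟩

/-- Hence at the trivial covering `unrVertAt Π_G A = A · Ker(Π_G ↠ Π^unr_G)`, the tree's recording of the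
unramified verticial subgroup through `A` (`IsUnrVerticial`). [cite: MochizukiCombGC2007, Def 1.1(ii) p.7] -/
theorem unrVertAt_top (A : Subgroup P) : G.unrVertAt ⊤ A = A ⊔ G.unrKer := by
  rw [unrVertAt, unrKerIn_top]

/-- … and `IsUnrVerticial (unrVertAt Π_G A)` for verticial `A`. [cite: MochizukiCombGC2007, Def 1.1(ii) p.7] -/
theorem isUnrVerticial_unrVertAt_top {A : Subgroup P} (hA : G.IsVerticial A) :
    G.IsUnrVerticial (G.unrVertAt ⊤ A) :=
  ⟨A, hA, G.unrVertAt_top A⟩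

omit [IsTopologicalGroup P] in
/-- A verticial subgroup of `Π_{G_Π} = Π_G` in the level-wise sense is a verticial subgroup.
[cite: MochizukiCombGC2007, Def 1.1(ii) p.6] -/
theorem isVerticial_of_isVerticialIn_top {A : Subgroup P} (hA : G.IsVerticialIn ⊤ A) : G.IsVerticial A := by
  obtain ⟨B, hB, rfl⟩ := hA
  rwa [top_inf_eq]

end PSCDatum

end Literature.AnabelianGeometry.SemiGraphs
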